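import Summits.ABC.ABC.Theorems.TwistAmplificationSharpModerateLawTwistMinimalInversion
import Summits.ABC.ABC.Theorems.TwistAmplificationSharpModerateLawTwistMinimalDecomposition
import Summits.ABC.ABC.Theorems.TwistAmplificationSharpModerateLawTwistMinimalScaling

/-!
# Crux `TwistAmplification.SharpModerateLaw` (stmt-ABC-1975) — skeleton v5.1 (lead prover-line-stmt-ABC-1975-c6-0, 2026-08-17)

Line `unit-plane-conic-two-torsion`, RESHAPED (v5, 03:13Z): the open residue of registry v4.2 (D1 ∧ D2 ∧ E′
`↔ SpreadLawCone ⟹ CoreLaw`) is replaced by the TWIST-ORBIT INVERSION partition of the canonical core `CoreLaw`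
(`…CoreDefs.lean`), objects in `…TwistMinimalDefs.lean` (p137420).

v5.1 (this file): the three PROVABLE stubs of v5 have LANDED and are imported by name —
* `stub_twistDecomposition : TwistDecomposition` — `…TwistMinimalDecomposition.lean` (p138250);
* `stub_twistScaling : TwistScaling` — `…TwistMinimalScaling.lean` (p138452);
* `stub_inversion : TwistDecomposition → TwistScaling → TwistOrbitInversion` — `…TwistMinimalInversion.lean` (p140703),
  lemmas `…TwistMinimalInversionLemmas.lean` (p140528);
so that exactly the two RESIDUAL stubs remain:
* `stub_coreLawTM : CoreLawTM` — the STATISTICAL residual (open; strictly below `CoreLaw`: `coreLawTM_of_coreLaw`; blind to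
  amplification: a Szpiro-type COUNTING law for twist-minimal cusp pairs in the window `X^{κ₀} ≤ Y ≤ X^{σ}`);
* `stub_pointwiseSzpiro : PointwiseSzpiroCusp` — the POINTWISE residual; THIS IS THE SUMMIT (`pointwiseSzpiroCusp_iff_abc :
  PointwiseSzpiroCusp ↔ ABC`, `…TwistMinimalPointwise.lean`, p140040; `←` half via `pointwiseSzpiroCusp_of_strongHall`,
  `…TwistMinimalPointwiseHall.lean`, p139128). No worker is put on it; it is registered so that the ledger shows exactly
  what the crux costs beyond the statistics: crux ⟸ CoreLawTM ∧ ABC (this file) and crux ⟹ ABC (`abc_of_sharpModerateLaw`).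

Composition: `CoreLaw` from the landed inversion applied to the two residuals, then the landed `sharpModerateLaw_of_coreLaw`
(p129886).
-/

noncomputable section

set_option linter.dupNamespace false

namespace Summit.ABC.ABC.Theorems.SharpModerateLaw

/-- Residual stub (OPEN, statistical, sub-summit): the core law on twist-minimal pairs. -/
theorem stub_coreLawTM : CoreLawTM := by
  sorry

/-- Residual stub (= the summit `ABC`, see `pointwiseSzpiroCusp_iff_abc`): generalized Szpiro in cusp coordinates. -/
theorem stub_pointwiseSzpiro : PointwiseSzpiroCusp := by
  sorry

/-- `TwistOrbitInversion` (= `CoreLawTM → PointwiseSzpiroCusp → CoreLaw`) holds: the three landed provable stubs composed. -/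
theorem twistOrbitInversion_of_stubs : TwistOrbitInversion :=
  stub_inversion stub_twistDecomposition stub_twistScaling

/-- `CoreLaw` from the v5 stubs (the landed inversion applied to the two residuals). -/
theorem coreLaw_of_stubs : CoreLaw :=
  twistOrbitInversion_of_stubs stub_coreLawTM stub_pointwiseSzpiro

/-- **Composition**: the crux BY NAME, through the landed `sharpModerateLaw_of_coreLaw`. -/
theorem SharpModerateLaw_of : Summit.ABC.ABC.Theses.TwistAmplification.SharpModerateLaw :=
  sharpModerateLaw_of_coreLaw coreLaw_of_stubs

end Summit.ABC.ABC.Theorems.SharpModerateLaw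

end
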